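import Mathlib
import HarnessLib
import Literature.Dynamics.Hyperbolic.RGFlowStableManifoldReducedLipschitz

/-!
# The fine-tuning theorem with norm-bound predicates, III: one contraction step for the MIXED
# SECOND DIFFERENCE of the tuned trajectories of four nearby systems
# ([ABKM19] Thm 12.1, smoothness content in difference form)

Continuation of `RGFlowStableManifoldReducedLipschitz.lean`.  There the contraction estimate of
[ABKM19] (12.43)–(12.46) is run on the DIFFERENCE of the tuned trajectories of two nearby systems
(`distQ_step`), giving Lipschitz dependence on the data.  Smoothness of the fine-tuned flow in the
data (the `C²` half of [ABKM19] Thm 12.1 / Thm 2.2) is consumed downstream only through BOUNDED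
MIXED SECOND DIFFERENCES, and these obey the same contraction scheme: for four systems
`(A^{ij}, B^{ij}, S^{ij}, y₀^{ij})`, `i, j ∈ {0,1}` (indexed by `Bool × Bool`; think of
`(i, j) = (p + iU, p + jV)` for two increments `U, V` of a parameter), with tuned trajectories
`x^{ij}` in the `ε`-tube, first differences of weighted size `D₁` (direction `i`) and `D₂`
(direction `j`), if `D` bounds the weighted second difference
`‖x^{11}_k − x^{10}_k − x^{01}_k + x^{00}_k‖, ‖y^{11}_k − …‖_k ≤ D η^k` then so does `κ D + Δ₂`, where
`Δ₂ = secondPertSize …` is BILINEAR in the first-difference data (`D₁, D₂`, the sizes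
`a₁, b₁, l₁'` / `a₂, b₂, l₂'` of the data differences, the second-difference sizes `a₁₂, b₁₂, l₁₂, m₁₂`,
and the parallelogram second-difference constant `σ₂` of the base step `S^{00}`).

* `RGFlow.secondPertSize` — the constant `Δ₂`;
* **`RGFlow.distQ2_step_rel`**, **`RGFlow.distQ2_step_irrel`**, **`RGFlow.distQ2_step`** — the step.

The algebra: `Σ± M^{ij} s^{ij} = M^{00}(Σ± s) + (M^{10} − M^{00})(s^{11} − s^{10}) +
(M^{01} − M^{00})(s^{11} − s^{01}) + (Σ± M) s^{11}` for the (linear) backward relevant equation, and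
`Σ± S^{ij}(z^{ij}) = [S^{00} over the quadrilateral z^{ij}] + [(S^{10} − S^{00})(z^{11}) − (S^{10} − S^{00})(z^{10})]
+ [(S^{01} − S^{00})(z^{11}) − (S^{01} − S^{00})(z^{01})] + (Σ± S)(z^{11})` for the forward irrelevant one,
the quadrilateral term being `S^{00}(z^{11}) − S^{00}(z^{10} + z^{01} − z^{00})` (Lipschitz × second
difference: the contraction) plus a parallelogram second difference of `S^{00}` (size `σ₂ D₁ D₂`).
Everything is proved; no named fact.  Iteration and the limit are left to the sequel.

## References
* S. Adams, S. Buchholz, R. Kotecký, S. Müller, arXiv:1910.13564, Ch. 12: Theorem 12.1,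
  (12.43)–(12.49), Lemma 12.6 [AdamsBuchholzKoteckyMuller2019].
* D. C. Brydges, IAS/Park City Math. Ser. 16 (2009), §2.10, Theorem 2.16 [Brydges2009].
-/

noncomputable section

open Set Function Metric Filter
open scoped NNReal Topology

namespace Literature.Dynamics.Hyperbolic

namespace RGFlow

variable {E : ℕ → Type*} [∀ k, NormedAddCommGroup (E k)] [∀ k, NormedSpace ℝ (E k)]
  {F : ℕ → Type*} [∀ k, AddCommGroup (F k)]

/-! ## §8 The size of the second-order perturbation -/

/-- The constant `Δ₂` of the second-difference contraction step: the maximum of the initial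
second difference `m₁₂`, the irrelevant contribution `(σ₂D₁D₂ + l₁'D₂ + l₂'D₁ + l₁₂ε)/η`, and the
relevant contribution `α(b₁D₂ + b₂D₁ + b₁₂ε) + (η+β)(a₁D₂ + a₂D₁ + a₁₂ε) + (a₁b₂ + a₂b₁)ε`
— bilinear in the first-order data. [cite: AdamsBuchholzKoteckyMuller2019, Ch. 12, eqs. (12.51)–(12.53)] -/
def secondPertSize (α β η ε σ₂ a₁ a₂ a₁₂ b₁ b₂ b₁₂ l₁' l₂' l₁₂ m₁₂ D₁ D₂ : ℝ) : ℝ :=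
  max m₁₂ (max ((σ₂ * D₁ * D₂ + l₁' * D₂ + l₂' * D₁ + l₁₂ * ε) / η)
    (α * (b₁ * D₂ + b₂ * D₁ + b₁₂ * ε) + (η + β) * (a₁ * D₂ + a₂ * D₁ + a₁₂ * ε) + (a₁ * b₂ + a₂ * b₁) * ε))

/-! ## §9 One contraction step for the mixed second difference -/

section secondStep

variable {N : ℕ} {r α β σ η κ ε σ₂ a₁ a₂ a₁₂ b₁ b₂ b₁₂ l₁' l₂' l₁₂ m₁₂ D₁ D₂ : ℝ}
  {Q : ∀ k, F k → ℝ → Prop}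
  {A : Bool → Bool → ∀ k, E k ≃L[ℝ] E (k + 1)} {B : Bool → Bool → ∀ k, F k →+ E (k + 1)}
  {S : Bool → Bool → ∀ k, E k → F k → F (k + 1)} {y₀ : Bool → Bool → F 0}
  {x : Bool → Bool → ∀ k, E k}

/-- **Relevant part of the second-difference step** (solved backwards): if `D` bounds the weighted
mixed second difference at all scales, `D₁, D₂` the first differences, then at every `k ≤ N`
`‖x^{11}_k − x^{10}_k − x^{01}_k + x^{00}_k‖ ≤ (κD + Δ₂) η^k`.
[cite: AdamsBuchholzKoteckyMuller2019, Ch. 12, eqs. (12.43)–(12.44)] -/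
theorem distQ2_step_rel (hT : ∀ i j, IsRGStepQ N r α β σ Q (A i j) (B i j) (S i j))
    (hη : 0 < η) (hα : 0 ≤ α) (hβ : 0 ≤ β) (hκ₁ : α * (η + β) ≤ κ)
    (htr : ∀ i j, IsTunedQ N (A i j) (B i j) (S i j) (y₀ i j) (x i j))
    (htu : ∀ i j, InTubeQ N η ε Q (S i j) (y₀ i j) (x i j))
    (ha₁0 : 0 ≤ a₁) (ha₂0 : 0 ≤ a₂) (ha₁₂0 : 0 ≤ a₁₂)
    (hΔ0 : 0 ≤ secondPertSize α β η ε σ₂ a₁ a₂ a₁₂ b₁ b₂ b₁₂ l₁' l₂' l₁₂ m₁₂ D₁ D₂)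
    (ha₁ : ∀ j k, k < N → ∀ w : E (k + 1), ‖(A true j k).symm w - (A false j k).symm w‖ ≤ a₁ * ‖w‖)
    (ha₂ : ∀ i k, k < N → ∀ w : E (k + 1), ‖(A i true k).symm w - (A i false k).symm w‖ ≤ a₂ * ‖w‖)
    (ha₁₂ : ∀ k, k < N → ∀ w : E (k + 1),
      ‖(A true true k).symm w - (A true false k).symm w - (A false true k).symm w + (A false false k).symm w‖
        ≤ a₁₂ * ‖w‖)
    (hb₁ : ∀ j k, k < N → ∀ (v : F k) (c : ℝ), Q k v c → ‖B true j k v - B false j k v‖ ≤ b₁ * c)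
    (hb₂ : ∀ i k, k < N → ∀ (v : F k) (c : ℝ), Q k v c → ‖B i true k v - B i false k v‖ ≤ b₂ * c)
    (hb₁₂ : ∀ k, k < N → ∀ (v : F k) (c : ℝ), Q k v c →
      ‖B true true k v - B true false k v - B false true k v + B false false k v‖ ≤ b₁₂ * c)
    (hD₁ : ∀ j k, k ≤ N → ‖x true j k - x false j k‖ ≤ D₁ * η ^ k ∧
      Q k (fwd (S true j) (y₀ true j) (x true j) k - fwd (S false j) (y₀ false j) (x false j) k) (D₁ * η ^ k))
    (hD₂ : ∀ i k, k ≤ N → ‖x i true k - x i false k‖ ≤ D₂ * η ^ k ∧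
      Q k (fwd (S i true) (y₀ i true) (x i true) k - fwd (S i false) (y₀ i false) (x i false) k) (D₂ * η ^ k))
    {D : ℝ} (hD0 : 0 ≤ D)
    (hD : ∀ k, k ≤ N → ‖x true true k - x true false k - x false true k + x false false k‖ ≤ D * η ^ k ∧
      Q k (fwd (S true true) (y₀ true true) (x true true) k - fwd (S true false) (y₀ true false) (x true false) k
        - fwd (S false true) (y₀ false true) (x false true) k + fwd (S false false) (y₀ false false) (x false false) k)
        (D * η ^ k)) :
    ∀ k, k ≤ N → ‖x true true k - x true false k - x false true k + x false false k‖
      ≤ (κ * D + secondPertSize α β η ε σ₂ a₁ a₂ a₁₂ b₁ b₂ b₁₂ l₁' l₂' l₁₂ m₁₂ D₁ D₂) * η ^ k := by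
  set Δ := secondPertSize α β η ε σ₂ a₁ a₂ a₁₂ b₁ b₂ b₁₂ l₁' l₂' l₁₂ m₁₂ D₁ D₂ with hΔ
  have hκ0 : 0 ≤ κ := le_trans (mul_nonneg hα (add_nonneg hη.le hβ)) hκ₁
  have hΔrel : α * (b₁ * D₂ + b₂ * D₁ + b₁₂ * ε) + (η + β) * (a₁ * D₂ + a₂ * D₁ + a₁₂ * ε)
      + (a₁ * b₂ + a₂ * b₁) * ε ≤ Δ := (le_max_right _ _).trans (le_max_right _ _)
  have hηk : ∀ k : ℕ, 0 ≤ η ^ k := fun k => pow_nonneg hη.le k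
  intro k hk
  rcases Nat.lt_or_ge k N with hkN | hkN
  · have hk1 : k + 1 ≤ N := hkN
    -- notation: `M^{ij} = (A^{ij}_k)⁻¹`, `s^{ij} = x^{ij}_{k+1} − B^{ij} y^{ij}_k`
    set y : Bool → Bool → F k := fun i j => fwd (S i j) (y₀ i j) (x i j) k with hy
    set s : Bool → Bool → E (k + 1) := fun i j => x i j (k + 1) - B i j k (y i j) with hs
    have hxk : ∀ i j, x i j k = (A i j k).symm (s i j) := by
      intro i j
      rw [hs]
      simp only
      rw [(htr i j).rel k hkN, add_sub_cancel_right, ContinuousLinearEquiv.symm_apply_apply]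
    -- the bilinear expansion of `Σ± M^{ij} s^{ij}`
    have hexp : x true true k - x true false k - x false true k + x false false k =
        (A false false k).symm (s true true - s true false - s false true + s false false)
        + ((A true false k).symm (s true true - s true false) - (A false false k).symm (s true true - s true false))
        + ((A false true k).symm (s true true - s false true) - (A false false k).symm (s true true - s false true))
        + ((A true true k).symm (s true true) - (A true false k).symm (s true true)
            - (A false true k).symm (s true true) + (A false false k).symm (s true true)) := by
      simp only [hxk, map_sub, map_add]
      abel
    -- sizes of the `s`-differences
    have hsd : ∀ i j i' j' (Dd bb : ℝ), ‖x i j (k + 1) - x i' j' (k + 1)‖ ≤ Dd * η ^ (k + 1) →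
        Q k (y i j - y i' j') (Dd * η ^ k) → ‖B i j k (y i' j') - B i' j' k (y i' j')‖ ≤ bb * (ε * η ^ k) →
        ‖s i j - s i' j'‖ ≤ Dd * η ^ (k + 1) + β * (Dd * η ^ k) + bb * (ε * η ^ k) := by
      intro i j i' j' Dd bb h1 h2 h3
      have hsplit : s i j - s i' j' = (x i j (k + 1) - x i' j' (k + 1))
          - (B i j k (y i j - y i' j') + (B i j k (y i' j') - B i' j' k (y i' j'))) := by
        simp only [hs, map_sub]; abel
      rw [hsplit, add_assoc]
      refine (norm_sub_le _ _).trans (add_le_add h1 ((norm_add_le _ _).trans (add_le_add ?_ h3)))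
      exact (hT i j).norm_B_le k hkN _ _ h2
    have hs2 : ‖s true true - s true false‖ ≤ D₂ * η ^ (k + 1) + β * (D₂ * η ^ k) + b₂ * (ε * η ^ k) :=
      hsd true true true false D₂ b₂ (hD₂ true (k + 1) hk1).1 (hD₂ true k hk).2
        (hb₂ true k hkN _ _ (htu true false k hk).2)
    have hs1 : ‖s true true - s false true‖ ≤ D₁ * η ^ (k + 1) + β * (D₁ * η ^ k) + b₁ * (ε * η ^ k) :=
      hsd true true false true D₁ b₁ (hD₁ true (k + 1) hk1).1 (hD₁ true k hk).2
        (hb₁ true k hkN _ _ (htu false true k hk).2)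
    have hs11 : ‖s true true‖ ≤ ε * η ^ (k + 1) + β * (ε * η ^ k) := by
      refine (norm_sub_le _ _).trans (add_le_add (htu true true (k + 1) hk1).1 ?_)
      exact (hT true true).norm_B_le k hkN _ _ (htu true true k hk).2
    -- the second difference of `s`
    have hByexp : B true true k (y true true) - B true false k (y true false) - B false true k (y false true)
        + B false false k (y false false) =
        B false false k (y true true - y true false - y false true + y false false)
        + (B true false k (y true true - y true false) - B false false k (y true true - y true false))
        + (B false true k (y true true - y false true) - B false false k (y true true - y false true))
        + (B true true k (y true true) - B true false k (y true true) - B false true k (y true true)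
            + B false false k (y true true)) := by
      simp only [map_sub, map_add]; abel
    have hBy : ‖B true true k (y true true) - B true false k (y true false) - B false true k (y false true)
        + B false false k (y false false)‖ ≤
        β * (D * η ^ k) + b₁ * (D₂ * η ^ k) + b₂ * (D₁ * η ^ k) + b₁₂ * (ε * η ^ k) := by
      rw [hByexp]
      refine (norm_add_le _ _).trans (add_le_add ((norm_add_le _ _).trans (add_le_add
        ((norm_add_le _ _).trans (add_le_add ?_ ?_)) ?_)) ?_)
      · exact (hT false false).norm_B_le k hkN _ _ (hD k hk).2
      · exact hb₁ false k hkN _ _ (hD₂ true k hk).2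
      · exact hb₂ false k hkN _ _ (hD₁ true k hk).2
      · exact hb₁₂ k hkN _ _ (htu true true k hk).2
    have hss : ‖s true true - s true false - s false true + s false false‖
        ≤ D * η ^ (k + 1) + (β * (D * η ^ k) + b₁ * (D₂ * η ^ k) + b₂ * (D₁ * η ^ k) + b₁₂ * (ε * η ^ k)) := by
      have hsplit : s true true - s true false - s false true + s false false =
          (x true true (k + 1) - x true false (k + 1) - x false true (k + 1) + x false false (k + 1))
          - (B true true k (y true true) - B true false k (y true false) - B false true k (y false true)
              + B false false k (y false false)) := by
        simp only [hs]; abel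
      rw [hsplit]
      exact (norm_sub_le _ _).trans (add_le_add (hD (k + 1) hk1).1 hBy)
    -- assemble
    rw [hexp]
    have h1 : ‖(A false false k).symm (s true true - s true false - s false true + s false false)‖
        ≤ α * (D * η ^ (k + 1) + (β * (D * η ^ k) + b₁ * (D₂ * η ^ k) + b₂ * (D₁ * η ^ k) + b₁₂ * (ε * η ^ k))) :=
      ((hT false false).norm_symm_le k hkN _).trans (mul_le_mul_of_nonneg_left hss hα)
    have h2 : ‖(A true false k).symm (s true true - s true false) - (A false false k).symm (s true true - s true false)‖
        ≤ a₁ * (D₂ * η ^ (k + 1) + β * (D₂ * η ^ k) + b₂ * (ε * η ^ k)) :=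
      (ha₁ false k hkN _).trans (mul_le_mul_of_nonneg_left hs2 ha₁0)
    have h3 : ‖(A false true k).symm (s true true - s false true) - (A false false k).symm (s true true - s false true)‖
        ≤ a₂ * (D₁ * η ^ (k + 1) + β * (D₁ * η ^ k) + b₁ * (ε * η ^ k)) :=
      (ha₂ false k hkN _).trans (mul_le_mul_of_nonneg_left hs1 ha₂0)
    have h4 : ‖(A true true k).symm (s true true) - (A true false k).symm (s true true)
        - (A false true k).symm (s true true) + (A false false k).symm (s true true)‖
        ≤ a₁₂ * (ε * η ^ (k + 1) + β * (ε * η ^ k)) :=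
      (ha₁₂ k hkN _).trans (mul_le_mul_of_nonneg_left hs11 ha₁₂0)
    refine ((norm_add_le _ _).trans (add_le_add ((norm_add_le _ _).trans (add_le_add
      ((norm_add_le _ _).trans (add_le_add h1 h2)) h3)) h4)).trans ?_
    rw [pow_succ η k]
    have hgoal : α * (D * (η ^ k * η) + (β * (D * η ^ k) + b₁ * (D₂ * η ^ k) + b₂ * (D₁ * η ^ k) + b₁₂ * (ε * η ^ k)))
        + a₁ * (D₂ * (η ^ k * η) + β * (D₂ * η ^ k) + b₂ * (ε * η ^ k))
        + a₂ * (D₁ * (η ^ k * η) + β * (D₁ * η ^ k) + b₁ * (ε * η ^ k))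
        + a₁₂ * (ε * (η ^ k * η) + β * (ε * η ^ k))
        = (α * (η + β) * D + (α * (b₁ * D₂ + b₂ * D₁ + b₁₂ * ε) + (η + β) * (a₁ * D₂ + a₂ * D₁ + a₁₂ * ε)
            + (a₁ * b₂ + a₂ * b₁) * ε)) * η ^ k := by ring
    rw [hgoal]
    exact mul_le_mul_of_nonneg_right (add_le_add (mul_le_mul_of_nonneg_right hκ₁ hD0) hΔrel) (hηk k)
  · obtain rfl : k = N := le_antisymm hk hkN
    rw [(htr true true).final, (htr true false).final, (htr false true).final, (htr false false).final]
    simp only [sub_zero, add_zero, norm_zero]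
    exact mul_nonneg (add_nonneg (mul_nonneg hκ0 hD0) hΔ0) (hηk _)

/-- **Irrelevant part of the second-difference step** (forwards): with the same bounds `D, D₁, D₂`,
at every `k ≤ N`, `‖y^{11}_k − y^{10}_k − y^{01}_k + y^{00}_k‖_k ≤ (κD + Δ₂) η^k`.  Uses: the Lipschitz
bound of `S^{00}` (the contraction, against the auxiliary vertex `z^{10} + z^{01} − z^{00}`, which lies in
the `3ε`-ball — whence `3ε ≤ r`), the parallelogram second differences `σ₂` of `S^{00}`, the
Lipschitz bounds `l₁', l₂'` of the difference maps `S^{10} − S^{00}`, `S^{01} − S^{00}`, and the data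
second difference `l₁₂`. [cite: AdamsBuchholzKoteckyMuller2019, Ch. 12, eqs. (12.45)–(12.46)] -/
theorem distQ2_step_irrel (hQ : IsSubaddNormBound Q)
    (hT : ∀ i j, IsRGStepQ N r α β σ Q (A i j) (B i j) (S i j))
    (hη : 0 < η) (hη1 : η ≤ 1) (hκ0 : 0 ≤ κ) (hκ₂ : σ ≤ κ * η) (hε : 0 ≤ ε) (hεr : 3 * ε ≤ r)
    (htu : ∀ i j, InTubeQ N η ε Q (S i j) (y₀ i j) (x i j))
    (hσ₂0 : 0 ≤ σ₂) (hD₁0 : 0 ≤ D₁) (hD₂0 : 0 ≤ D₂)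
    (hl₁ : ∀ k, k < N → ∀ (u u' : E k) (v v' : F k) (cv cv' c : ℝ), ‖u‖ ≤ r → ‖u'‖ ≤ r →
      Q k v cv → cv ≤ r → Q k v' cv' → cv' ≤ r → Q k (v - v') c →
      Q (k + 1) ((S true false k u v - S false false k u v) - (S true false k u' v' - S false false k u' v'))
        (l₁' * max ‖u - u'‖ c))
    (hl₂ : ∀ k, k < N → ∀ (u u' : E k) (v v' : F k) (cv cv' c : ℝ), ‖u‖ ≤ r → ‖u'‖ ≤ r →
      Q k v cv → cv ≤ r → Q k v' cv' → cv' ≤ r → Q k (v - v') c →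
      Q (k + 1) ((S false true k u v - S false false k u v) - (S false true k u' v' - S false false k u' v'))
        (l₂' * max ‖u - u'‖ c))
    (hl₁₂ : ∀ k, k < N → ∀ (u : E k) (v : F k) (cv : ℝ), ‖u‖ ≤ r → Q k v cv → cv ≤ r →
      Q (k + 1) (S true true k u v - S true false k u v - S false true k u v + S false false k u v)
        (l₁₂ * max ‖u‖ cv))
    (hσ₂ : ∀ k, k < N → ∀ (u y z : E k) (v y' z' : F k) (cv cvy cvz cvyz cy cz : ℝ),
      ‖u‖ ≤ r → ‖u + y‖ ≤ r → ‖u + z‖ ≤ r → ‖u + y + z‖ ≤ r →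
      Q k v cv → cv ≤ r → Q k (v + y') cvy → cvy ≤ r → Q k (v + z') cvz → cvz ≤ r →
      Q k (v + y' + z') cvyz → cvyz ≤ r → Q k y' cy → Q k z' cz →
      Q (k + 1) (S false false k (u + y + z) (v + y' + z') - S false false k (u + y) (v + y')
          - S false false k (u + z) (v + z') + S false false k u v) (σ₂ * max ‖y‖ cy * max ‖z‖ cz))
    (hm₁₂ : Q 0 (y₀ true true - y₀ true false - y₀ false true + y₀ false false) m₁₂)
    (hD₁ : ∀ j k, k ≤ N → ‖x true j k - x false j k‖ ≤ D₁ * η ^ k ∧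
      Q k (fwd (S true j) (y₀ true j) (x true j) k - fwd (S false j) (y₀ false j) (x false j) k) (D₁ * η ^ k))
    (hD₂ : ∀ i k, k ≤ N → ‖x i true k - x i false k‖ ≤ D₂ * η ^ k ∧
      Q k (fwd (S i true) (y₀ i true) (x i true) k - fwd (S i false) (y₀ i false) (x i false) k) (D₂ * η ^ k))
    {D : ℝ} (hD0 : 0 ≤ D)
    (hD : ∀ k, k ≤ N → ‖x true true k - x true false k - x false true k + x false false k‖ ≤ D * η ^ k ∧
      Q k (fwd (S true true) (y₀ true true) (x true true) k - fwd (S true false) (y₀ true false) (x true false) k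
        - fwd (S false true) (y₀ false true) (x false true) k + fwd (S false false) (y₀ false false) (x false false) k)
        (D * η ^ k)) :
    ∀ k, k ≤ N →
      Q k (fwd (S true true) (y₀ true true) (x true true) k - fwd (S true false) (y₀ true false) (x true false) k
        - fwd (S false true) (y₀ false true) (x false true) k + fwd (S false false) (y₀ false false) (x false false) k)
        ((κ * D + secondPertSize α β η ε σ₂ a₁ a₂ a₁₂ b₁ b₂ b₁₂ l₁' l₂' l₁₂ m₁₂ D₁ D₂) * η ^ k) := by
  set Δ := secondPertSize α β η ε σ₂ a₁ a₂ a₁₂ b₁ b₂ b₁₂ l₁' l₂' l₁₂ m₁₂ D₁ D₂ with hΔ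
  have hΔm : m₁₂ ≤ Δ := le_max_left _ _
  have hΔirr : (σ₂ * D₁ * D₂ + l₁' * D₂ + l₂' * D₁ + l₁₂ * ε) / η ≤ Δ :=
    (le_max_left _ _).trans (le_max_right _ _)
  have hηk : ∀ k : ℕ, 0 ≤ η ^ k := fun k => pow_nonneg hη.le k
  have hηk1 : ∀ k : ℕ, η ^ k ≤ 1 := fun k => pow_le_one₀ hη.le hη1
  have hεr1 : ε ≤ r := by linarith
  have hball : ∀ (t : ℝ) (k : ℕ), t ≤ ε * η ^ k → t ≤ r :=
    fun t k ht => ht.trans ((mul_le_of_le_one_right hε (hηk1 k)).trans hεr1)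
  have hball3 : ∀ k : ℕ, 3 * (ε * η ^ k) ≤ r :=
    fun k => le_trans (by nlinarith [hηk1 k, hηk k]) hεr
  intro k hk
  rcases Nat.eq_zero_or_eq_succ_pred k with hk0 | hks
  · subst hk0
    simp only [fwd_zero, pow_zero, mul_one]
    exact hQ.mono _ _ _ _ hm₁₂ (hΔm.trans (le_add_of_nonneg_left (mul_nonneg hκ0 hD0)))
  · set j := k.pred with hj
    rw [hks] at hk ⊢
    have hjN : j < N := Nat.lt_of_succ_le hk
    have hjle : j ≤ N := hjN.le
    simp only [fwd_succ]
    -- notation for the scale-`j` data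
    set u : Bool → Bool → E j := fun i i' => x i i' j with hu
    set v : Bool → Bool → F j := fun i i' => fwd (S i i') (y₀ i i') (x i i') j with hv
    have hux : ∀ i i', x i i' j = u i i' := fun _ _ => rfl
    have hvy : ∀ i i', fwd (S i i') (y₀ i i') (x i i') j = v i i' := fun _ _ => rfl
    simp only [hux, hvy]
    -- tube data
    have hun : ∀ i i', ‖u i i'‖ ≤ ε * η ^ j := fun i i' => (htu i i' j hjle).1
    have hvn : ∀ i i', Q j (v i i') (ε * η ^ j) := fun i i' => (htu i i' j hjle).2
    -- first differences at scale `j`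
    have hY : ‖u true false - u false false‖ ≤ D₁ * η ^ j := (hD₁ false j hjle).1
    have hY' : Q j (v true false - v false false) (D₁ * η ^ j) := (hD₁ false j hjle).2
    have hZ : ‖u false true - u false false‖ ≤ D₂ * η ^ j := (hD₂ false j hjle).1
    have hZ' : Q j (v false true - v false false) (D₂ * η ^ j) := (hD₂ false j hjle).2
    have h12 : ‖u true true - u true false‖ ≤ D₂ * η ^ j := (hD₂ true j hjle).1
    have h12' : Q j (v true true - v true false) (D₂ * η ^ j) := (hD₂ true j hjle).2
    have h21 : ‖u true true - u false true‖ ≤ D₁ * η ^ j := (hD₁ true j hjle).1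
    have h21' : Q j (v true true - v false true) (D₁ * η ^ j) := (hD₁ true j hjle).2
    have hΔu : ‖u true true - u true false - u false true + u false false‖ ≤ D * η ^ j := (hD j hjle).1
    have hΔv : Q j (v true true - v true false - v false true + v false false) (D * η ^ j) := (hD j hjle).2
    -- the auxiliary vertex
    set wu : E j := u false false + (u true false - u false false) + (u false true - u false false) with hwu
    set wv : F j := v false false + (v true false - v false false) + (v false true - v false false) with hwv
    have eu1 : u false false + (u true false - u false false) = u true false := by abel
    have eu2 : u false false + (u false true - u false false) = u false true := by abel
    have ev1 : v false false + (v true false - v false false) = v true false := by abel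
    have ev2 : v false false + (v false true - v false false) = v false true := by abel
    have hwun : ‖wu‖ ≤ r := by
      have : wu = u true false + u false true - u false false := by rw [hwu]; abel
      rw [this]
      calc ‖u true false + u false true - u false false‖
          ≤ ‖u true false‖ + ‖u false true‖ + ‖u false false‖ :=
            (norm_sub_le _ _).trans (add_le_add (norm_add_le _ _) le_rfl)
        _ ≤ ε * η ^ j + ε * η ^ j + ε * η ^ j := by gcongr <;> exact hun _ _
        _ = 3 * (ε * η ^ j) := by ring
        _ ≤ r := hball3 j
    have hwvQ : Q j wv (3 * (ε * η ^ j)) := by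
      have h := hQ.sub j _ _ _ _ (hQ.add j _ _ _ _ (hvn true false) (hvn false true)) (hvn false false)
      have e : v true false + v false true - v false false = wv := by rw [hwv]; abel
      rw [e, show ε * η ^ j + ε * η ^ j + ε * η ^ j = 3 * (ε * η ^ j) by ring] at h
      exact h
    have hΔuw : u true true - wu = u true true - u true false - u false true + u false false := by
      rw [hwu]; abel
    have hΔvw : v true true - wv = v true true - v true false - v false true + v false false := by
      rw [hwv]; abel
    -- the decomposition
    have hdec : S true true j (u true true) (v true true) - S true false j (u true false) (v true false)
        - S false true j (u false true) (v false true) + S false false j (u false false) (v false false) =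
        ((S false false j (u true true) (v true true) - S false false j wu wv)
          + (S false false j (u false false + (u true false - u false false) + (u false true - u false false))
              (v false false + (v true false - v false false) + (v false true - v false false))
            - S false false j (u false false + (u true false - u false false)) (v false false + (v true false - v false false))
            - S false false j (u false false + (u false true - u false false)) (v false false + (v false true - v false false))
            + S false false j (u false false) (v false false)))
        + (((S true false j (u true true) (v true true) - S false false j (u true true) (v true true))
            - (S true false j (u true false) (v true false) - S false false j (u true false) (v true false)))
          + ((S false true j (u true true) (v true true) - S false false j (u true true) (v true true))
            - (S false true j (u false true) (v false true) - S false false j (u false true) (v false true))))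
        + (S true true j (u true true) (v true true) - S true false j (u true true) (v true true)
            - S false true j (u true true) (v true true) + S false false j (u true true) (v true true)) := by
      rw [← hwu, ← hwv, eu1, eu2, ev1, ev2]
      abel
    rw [hdec]
    -- the five estimates
    have hIa : Q (j + 1) (S false false j (u true true) (v true true) - S false false j wu wv) (σ * (D * η ^ j)) := by
      have h := (hT false false).lipschitz j hjN (u true true) wu (v true true) wv _ _ (D * η ^ j)
        (hball _ j (hun true true)) hwun (hvn true true) (hball _ j le_rfl) hwvQ (hball3 j)
        (by rw [hΔvw]; exact hΔv)
      rwa [hΔuw, max_eq_right hΔu] at h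
    have hIb : Q (j + 1) (S false false j (u false false + (u true false - u false false) + (u false true - u false false))
          (v false false + (v true false - v false false) + (v false true - v false false))
        - S false false j (u false false + (u true false - u false false)) (v false false + (v true false - v false false))
        - S false false j (u false false + (u false true - u false false)) (v false false + (v false true - v false false))
        + S false false j (u false false) (v false false)) (σ₂ * (D₁ * η ^ j) * (D₂ * η ^ j)) := by
      have h := hσ₂ j hjN (u false false) (u true false - u false false) (u false true - u false false)
        (v false false) (v true false - v false false) (v false true - v false false)
        (ε * η ^ j) (ε * η ^ j) (ε * η ^ j) (3 * (ε * η ^ j)) (D₁ * η ^ j) (D₂ * η ^ j)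
        (hball _ j (hun false false)) (by rw [eu1]; exact hball _ j (hun true false))
        (by rw [eu2]; exact hball _ j (hun false true)) hwun
        (hvn false false) (hball _ j le_rfl) (by rw [ev1]; exact hvn true false) (hball _ j le_rfl)
        (by rw [ev2]; exact hvn false true) (hball _ j le_rfl) hwvQ (hball3 j) hY' hZ'
      rwa [max_eq_right hY, max_eq_right hZ] at h
    have hII : Q (j + 1) ((S true false j (u true true) (v true true) - S false false j (u true true) (v true true))
        - (S true false j (u true false) (v true false) - S false false j (u true false) (v true false)))
        (l₁' * (D₂ * η ^ j)) := by
      have h := hl₁ j hjN (u true true) (u true false) (v true true) (v true false) _ _ (D₂ * η ^ j)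
        (hball _ j (hun true true)) (hball _ j (hun true false)) (hvn true true) (hball _ j le_rfl)
        (hvn true false) (hball _ j le_rfl) h12'
      rwa [max_eq_right h12] at h
    have hIII : Q (j + 1) ((S false true j (u true true) (v true true) - S false false j (u true true) (v true true))
        - (S false true j (u false true) (v false true) - S false false j (u false true) (v false true)))
        (l₂' * (D₁ * η ^ j)) := by
      have h := hl₂ j hjN (u true true) (u false true) (v true true) (v false true) _ _ (D₁ * η ^ j)
        (hball _ j (hun true true)) (hball _ j (hun false true)) (hvn true true) (hball _ j le_rfl)
        (hvn false true) (hball _ j le_rfl) h21'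
      rwa [max_eq_right h21] at h
    have hIV : Q (j + 1) (S true true j (u true true) (v true true) - S true false j (u true true) (v true true)
        - S false true j (u true true) (v true true) + S false false j (u true true) (v true true))
        (l₁₂ * (ε * η ^ j)) := by
      have h := hl₁₂ j hjN (u true true) (v true true) (ε * η ^ j) (hball _ j (hun true true)) (hvn true true)
        (hball _ j le_rfl)
      rwa [max_eq_right (hun true true)] at h
    have htot := hQ.add _ _ _ _ _ (hQ.add _ _ _ _ _ (hQ.add _ _ _ _ _ hIa hIb) (hQ.add _ _ _ _ _ hII hIII)) hIV
    refine hQ.mono _ _ _ _ htot ?_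
    -- the arithmetic
    rw [pow_succ]
    have hσD : σ * (D * η ^ j) ≤ κ * D * (η ^ j * η) := by
      have := mul_le_mul_of_nonneg_right hκ₂ (mul_nonneg hD0 (hηk j))
      calc σ * (D * η ^ j) ≤ κ * η * (D * η ^ j) := this
        _ = κ * D * (η ^ j * η) := by ring
    have hrest : σ₂ * (D₁ * η ^ j) * (D₂ * η ^ j) + (l₁' * (D₂ * η ^ j) + l₂' * (D₁ * η ^ j)) + l₁₂ * (ε * η ^ j)
        ≤ Δ * (η ^ j * η) := by
      have h1 : σ₂ * (D₁ * η ^ j) * (D₂ * η ^ j) ≤ σ₂ * D₁ * D₂ * η ^ j := by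
        have : σ₂ * (D₁ * η ^ j) * (D₂ * η ^ j) = (σ₂ * D₁ * D₂ * η ^ j) * η ^ j := by ring
        rw [this]
        exact mul_le_of_le_one_right (by positivity) (hηk1 j)
      have h2 : σ₂ * D₁ * D₂ * η ^ j + (l₁' * (D₂ * η ^ j) + l₂' * (D₁ * η ^ j)) + l₁₂ * (ε * η ^ j)
          = (σ₂ * D₁ * D₂ + l₁' * D₂ + l₂' * D₁ + l₁₂ * ε) / η * (η ^ j * η) := by
        field_simp
        ring
      calc σ₂ * (D₁ * η ^ j) * (D₂ * η ^ j) + (l₁' * (D₂ * η ^ j) + l₂' * (D₁ * η ^ j)) + l₁₂ * (ε * η ^ j)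
          ≤ σ₂ * D₁ * D₂ * η ^ j + (l₁' * (D₂ * η ^ j) + l₂' * (D₁ * η ^ j)) + l₁₂ * (ε * η ^ j) := by
            linarith
        _ = (σ₂ * D₁ * D₂ + l₁' * D₂ + l₂' * D₁ + l₁₂ * ε) / η * (η ^ j * η) := h2
        _ ≤ Δ * (η ^ j * η) := mul_le_mul_of_nonneg_right hΔirr (mul_nonneg (hηk j) hη.le)
    calc σ * (D * η ^ j) + σ₂ * (D₁ * η ^ j) * (D₂ * η ^ j) + (l₁' * (D₂ * η ^ j) + l₂' * (D₁ * η ^ j))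
          + l₁₂ * (ε * η ^ j)
        = σ * (D * η ^ j) + (σ₂ * (D₁ * η ^ j) * (D₂ * η ^ j) + (l₁' * (D₂ * η ^ j) + l₂' * (D₁ * η ^ j))
          + l₁₂ * (ε * η ^ j)) := by ring
      _ ≤ κ * D * (η ^ j * η) + Δ * (η ^ j * η) := add_le_add hσD hrest
      _ = (κ * D + Δ) * (η ^ j * η) := by ring


end secondStep

end RGFlow

end Literature.Dynamics.Hyperbolic

end
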